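import Literature.Geometry.Riemannian.GurskyViaclovskyLinearisation
import HarnessLib

/-!
# The maximum-principle `C⁰` bound, uniform along the method-of-continuity segment
(helper `helper_segmentSupBound` of stub O2 `stub_linearisedInvertible` of line
`margerin-cone-hamilton-rails`, crux `EntropyRung.ChangGurskyYang`, item stmt-SmoothPoincare4-10834)

Gursky–Viaclovsky 2003, Prop. 2 (J. Differential Geom. 63 (2003), §2): at an admissible solution
`w` of the weighted path equation on the background (`backgroundScalar g w > 0`,
`backgroundPathOperator g t w = q e^{−4w}`, `t ≤ 1`, `q > 0`) the linearisation
`L φ = 𝓛_{t,w} φ + 4 q e^{−4w} φ`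
(`Literature.Geometry.Riemannian.GurskyViaclovskyPath.linearisedBackgroundOperator`) is an
isomorphism of the Hölder spaces. The surjectivity is obtained by the method of continuity
(Gilbarg–Trudinger 2001, Thm. 5.2) along the segment
`L_s = (1 − s)(Δ_g − 1) + s(−L)`, `s ∈ [0, 1]`, from the model operator `Δ_g − 1`; the uniform
estimate `‖u‖ ≤ C‖L_s u‖` along the segment needs, besides the Schauder estimate, the `C⁰` bound of
this file:

* `helper_segmentSupBound` (registered) — **there is `C₀` (independent of `s` and `u`) with
  `sup|u| ≤ C₀ · sup|L_s u|` for every `s ∈ [0,1]` and every `u ∈ C²(M)`**. Indeed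
  `L_s u = ⟨P_s, Hess_g u⟩_g + du(b_s) + c_s u` with
  `P_s = (1−s) g + s(−P)` symmetric positive semidefinite (`g` Riemannian;
  `−P ≥ 0` is the ellipticity `neg_principalForm_apply_self_nonneg` of the linearised operator at
  an admissible solution, GV Prop. 1 (ii)), `b_s = −s b`, and
  `c_s = −(1−s) − 4 s q e^{−4w} ≤ −min(1, c₁)`, `c₁ = 4 min_M q e^{−4w} > 0` (compact `M`), so the
  closed-manifold maximum principle `mul_abs_le_of_maximumPrinciple`
  (`EllipticMaximumPrincipleClosed.lean`; Gilbarg–Trudinger 2001, Thm. 3.7) gives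
  `min(1, c₁)·|u| ≤ sup|L_s u|`; `C₀ = 1 / min(1, c₁)`.

Everything is proved; no definition, no named fact. The bookkeeping (symmetry of `P` from
`ricci_symm_holds`, `hessian_symm_holds`, `g.symm`; `⟨g, Hess u⟩_g = tr_g Hess u = Δ_g u` by
`innerBilin_toBilinForm`) follows the template `eq_zero_of_linearised_eq_zero`
(`GurskyViaclovskyLinearisation.lean`, the case `s = 1`).

References: M. J. Gursky, J. A. Viaclovsky, J. Differential Geom. 63 (2003) 131–154, §2, Prop. 2
[GurskyViaclovsky2003]; D. Gilbarg, N. S. Trudinger, *Elliptic partial differential equations of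
second order* (2001), Thm. 3.7 and Thm. 5.2 [GilbargTrudinger2001].
-/

noncomputable section

-- the registered namespace `Summit.SmoothPoincare4.SmoothPoincare4.Theorems` repeats a component
set_option linter.dupNamespace false

open Set Filter
open scoped Manifold ContDiff Topology

namespace Summit.SmoothPoincare4.SmoothPoincare4.Theorems.MargerinRails

open Literature.Geometry.Riemannian
open Literature.Geometry.Riemannian.GurskyViaclovskyPath
open Literature.Geometry.Lorentzian (PseudoRiemannianMetric)
open Literature.Geometry.Lorentzian.PseudoRiemannianMetric

/-- **Uniform `C⁰` bound along the continuity segment** (Gursky–Viaclovsky 2003, proof of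
Prop. 2, with Gilbarg–Trudinger 2001, Thm. 3.7 / Thm. 5.2). Let `M` be a closed `4`-manifold with
a smooth Riemannian `g`, `q > 0` continuous, `t ≤ 1`, and `w ∈ C²(M)` an admissible solution of
the background path equation (`backgroundScalar g w > 0`,
`backgroundPathOperator g t w = q e^{−4w}`). Then there is `C₀` such that for every `s ∈ [0,1]`,
every `u ∈ C²(M)` and every `B` with
`|(1−s)(Δ_g u − u) − s(𝓛_{t,w} u + 4 q e^{−4w} u)| ≤ B` on `M`, one has `|u| ≤ C₀ B` on `M`:
the operator `L_s = (1−s)(Δ_g − 1) + s(−(𝓛 + 4qe^{−4w}))` is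
`⟨(1−s)g − sP, Hess_g u⟩_g + du(−s b) + c_s u` with `(1−s)g − sP ≥ 0`
(`neg_principalForm_apply_self_nonneg`) and `c_s = −(1−s) − 4sqe^{−4w} ≤ −min(1, 4 min qe^{−4w})`,
so `mul_abs_le_of_maximumPrinciple` applies with a constant independent of `s`.
[cite: GurskyViaclovsky2003, §2, proof of Prop. 2] -/
theorem helper_segmentSupBound :
    ∀ (M : Type) [TopologicalSpace M] [T2Space M] [ChartedSpace (EuclideanSpace ℝ (Fin 4)) M]
      [IsManifold (modelWithCornersSelf ℝ (EuclideanSpace ℝ (Fin 4))) ((⊤ : ℕ∞) : WithTop ℕ∞) M]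
      [CompactSpace M]
      (g : Literature.Geometry.Lorentzian.PseudoRiemannianMetric
        (modelWithCornersSelf ℝ (EuclideanSpace ℝ (Fin 4))) ((⊤ : ℕ∞) : WithTop ℕ∞)
        (EuclideanSpace ℝ (Fin 4))
        (TangentSpace (modelWithCornersSelf ℝ (EuclideanSpace ℝ (Fin 4))) : M → Type _))
      [g.HasLeviCivita], g.IsRiemannian →
      ∀ (q : M → ℝ), Continuous q → (∀ x, 0 < q x) → ∀ (t : ℝ), t ≤ 1 →
      ∀ (w : M → ℝ), ContMDiff (modelWithCornersSelf ℝ (EuclideanSpace ℝ (Fin 4)))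
        (modelWithCornersSelf ℝ ℝ) 2 w →
      (∀ x, 0 < Literature.Geometry.Riemannian.GurskyViaclovskyPath.backgroundScalar g w x) →
      (∀ x, Literature.Geometry.Riemannian.GurskyViaclovskyPath.backgroundPathOperator g t w x =
        q x * Real.exp (-4 * w x)) →
      ∃ C₀ : ℝ, ∀ s ∈ Set.Icc (0 : ℝ) 1, ∀ (u : M → ℝ),
        ContMDiff (modelWithCornersSelf ℝ (EuclideanSpace ℝ (Fin 4))) (modelWithCornersSelf ℝ ℝ) 2 u →
        ∀ B : ℝ, (∀ y, |(1 - s) * (g.dalembertian u y - u y)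
          - s * (Literature.Geometry.Riemannian.GurskyViaclovskyPath.linearisedBackgroundOperator g t w u y
            + 4 * q y * Real.exp (-4 * w y) * u y)| ≤ B) →
        ∀ x, |u x| ≤ C₀ * B := by
  intro M _ _ _ _ _ g _ hg q hqc hq t ht w hw hρ heq
  rcases isEmpty_or_nonempty M with hM | hM
  · exact ⟨0, fun s _ u _ B _ x ↦ (IsEmpty.false x).elim⟩
  -- the zeroth-order coefficient `4 q e^{-4w}` is bounded below by `c₁ > 0` on the compact `M`
  have hcont : Continuous fun x ↦ q x * Real.exp (-4 * w x) :=
    hqc.mul (Real.continuous_exp.comp (continuous_const.mul hw.continuous))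
  obtain ⟨x₀, -, hx₀⟩ := isCompact_univ.exists_isMinOn univ_nonempty hcont.continuousOn
  set c₁ := 4 * (q x₀ * Real.exp (-4 * w x₀)) with hc₁
  have hc₁pos : 0 < c₁ := by
    have := mul_pos (hq x₀) (Real.exp_pos (-4 * w x₀))
    positivity
  -- the constant of the segment, independent of `s` and `u`
  set c₀ := min 1 c₁ with hc₀
  have hc₀pos : 0 < c₀ := lt_min one_pos hc₁pos
  have hc₀le1 : c₀ ≤ 1 := min_le_left _ _
  have hc₀lec₁ : c₀ ≤ c₁ := min_le_right _ _
  have h2le : (2 : ℕ∞ω) ≤ ∞ := WithTop.coe_le_coe.mpr le_top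
  refine ⟨c₀⁻¹, fun s hs u hu B hB x ↦ ?_⟩
  obtain ⟨hs0, hs1⟩ := hs
  rw [le_inv_mul_iff₀ hc₀pos]
  refine mul_abs_le_of_maximumPrinciple g (fun x v hv ↦ hg x v hv)
    (P := fun x ↦ (1 - s) • g.toBilinForm x + (-s) • principalForm g t w x) ?_ ?_
    (fun x ↦ (-s) • firstOrderField g t w x)
    (c := fun x ↦ -(1 - s) - s * (4 * q x * Real.exp (-4 * w x))) hc₀pos ?_ hu ?_ x
  · -- symmetry of `P_s = (1-s) g - s P`
    intro x v v'
    have hR : g.ricci x v v' = g.ricci x v' v := (g.ricci_symm_holds h2le x).eq v v'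
    have hH : g.hessian w x v v' = g.hessian w x v' v := (g.hessian_symm_holds (hw x)).eq v v'
    simp only [LinearMap.add_apply, LinearMap.smul_apply, smul_eq_mul, principalForm_apply,
      toBilinForm_apply]
    rw [hR, hH, g.symm x v v', mul_comm (mvfderiv (𝓡 4) w x v) (mvfderiv (𝓡 4) w x v')]
  · -- `P_s ≥ 0`: `g ≥ 0` (Riemannian) and `-P ≥ 0` (ellipticity at the admissible solution)
    intro x v
    have h1 : 0 ≤ g.val x v v := by
      by_cases hv : v = 0
      · subst hv; simp
      · exact (hg x v hv).le
    have h2 : 0 ≤ -(principalForm g t w x v v) :=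
      neg_principalForm_apply_self_nonneg g hg ht (hρ x) (hq x) (heq x) v
    simp only [LinearMap.add_apply, LinearMap.smul_apply, smul_eq_mul, toBilinForm_apply]
    nlinarith [mul_nonneg (sub_nonneg.2 hs1) h1, mul_nonneg hs0 h2]
  · -- `c_s ≤ -c₀`
    intro x
    have hmin : q x₀ * Real.exp (-4 * w x₀) ≤ q x * Real.exp (-4 * w x) := hx₀ (mem_univ x)
    have h4 : c₁ ≤ 4 * q x * Real.exp (-4 * w x) := by rw [hc₁]; linarith
    nlinarith [mul_le_mul_of_nonneg_left hc₀le1 (sub_nonneg.2 hs1),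
      mul_le_mul_of_nonneg_left (hc₀lec₁.trans h4) hs0]
  · -- `L_s u` is the given combination
    intro y
    have hd : g.dalembertian u y = g.trace y (g.hessian u y) := rfl
    have key : g.innerBilin y ((1 - s) • g.toBilinForm y + (-s) • principalForm g t w y)
          (g.hessian u y)
        + mvfderiv (𝓡 4) u y ((-s) • firstOrderField g t w y)
        + (-(1 - s) - s * (4 * q y * Real.exp (-4 * w y))) * u y
      = (1 - s) * (g.dalembertian u y - u y)
        - s * (linearisedBackgroundOperator g t w u y + 4 * q y * Real.exp (-4 * w y) * u y) := by
      simp only [innerBilin_add_left, innerBilin_smul_left, map_smul, smul_eq_mul,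
        linearisedBackgroundOperator]
      rw [g.innerBilin_comm y (g.toBilinForm y), innerBilin_toBilinForm, hd]
      ring
    rw [key]
    exact hB y

end Summit.SmoothPoincare4.SmoothPoincare4.Theorems.MargerinRails

end
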